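/-
Copyright (c) 2026 the pub-hodgecm-mathlib formalisation cell (harness21).  Prover seat hodgecm-mathlib-K2Liu-p09 (g0): Track B «K2-LIT»,
#184♮ = hLiu418 = stmt-HodgeConjecture-24832, LEAD F0P6-plan (g10) «SKELETON LANDED K2Liu №2» (K2/STATUS 20:51:12Z) and DEAL BY NAME
(20:51:45Z), file #9 of the K2_Liu road (planner K2Liu-plan (g0), socket module
`Cruxes/HLiu418/Lines/K2_Liu_CurveThetaSigs_U3a_SiegelEisenstein.lean` feca6d8e9697719e); 2026-09-03.
-/
import Literature.NumberTheory.K2Lit.SiegelEisensteinSeriesDoubled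
import Mathlib.Analysis.SpecialFunctions.Pow.Complex
import Mathlib.Analysis.SpecialFunctions.Pow.Real
import Mathlib.Topology.Algebra.InfiniteSum.Real
import HarnessLib

/-!
# Crux `HLiu418`, Track B road `K2_Liu` (Liu 2021, Thm. B.4 (1)), unit U3a «SIEGEL EISENSTEIN SERIES», file #9 — helper 1 of 3:
# the REDUCTION of the absolute convergence of the Siegel–hermitian Eisenstein series to Godement's height count

Cell `hodgecm-mathlib`, crux item hLiu418 = `stmt-HodgeConjecture-24832`, route of record `HCCMUnconditional`; squad K2 ∕ K2Liu,
LEAD F0P6-plan (g10), planner K2Liu-plan (g0), prover K2Liu-p09 (g0).  THEOREMS ONLY (no `def`, no instance, no notation, no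
named-fact hypothesis, no `sorry`, default heartbeats); imports = ★ K2Lit leaf D2-bis `SiegelEisensteinSeriesDoubled` (p854694:
`siegelDeltaCharacter`, `IsSiegelDeltaSection`, `SiegelDeltaQuot`, `modDelta_pos`) + Mathlib + HarnessLib;
lane `--supports stmt-HodgeConjecture-24832` (count-neutral helper toward socket #9 `sig_K2LiuSiegelEisensteinDoubledSummable`).

THE SOCKET (#9, frozen bytes, NOT proved in this file): for a unitary Hecke character `χ`, `Re s > n/2`, and a continuous
Siegel section `f` of `I(s, χ)` on the doubled group `H(𝔸) = U(𝕍 ⊕ −𝕍)(𝔸)` of the CM datum of record, the family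
`γ ↦ ‖f(γ h)‖` over `P_Δ(L⁺)\H(L⁺)` is summable — Godement's criterion for the Siegel parabolic of `U(n,n)`
([Liu2021, §B.3 p. 101 «absolutely convergent for Re(s) > (n+a)/2», Lem. B.10 (2)]; [Tan1999, §1]; [Garrett2018, §3.10]).
Its proof has three organs: (I) an Iwasawa decomposition `H(𝔸) = P_Δ(𝔸) · K` with `K` compact; (II) the bound of a
CONTINUOUS section by the spherical height on `K`-translates; (III) GODEMENT'S COUNT — summability of the `(2 Re s + n)`-th power of a
height function of type `(P_Δ, |det_Δ|^{1/2})` over `P_Δ(L⁺)\H(L⁺)` for `2 Re s + n > 2n`.  THIS FILE proves (II) and the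
composition «(I) ∧ (III) ⇒ #9» with (I) and (III) as explicit data-level hypotheses (no named fact):

* §1 `norm_chiDet_eq_one`, `norm_siegelDeltaCharacter` — for UNITARY `χ` (★ `HeckeCharacter.IsUnitary`),
  `‖χ(det_Δ p) · |det_Δ p|^{s + n/2}‖ = modDelta(p)^{2 Re s + n}` (★ `modDelta p = |det_Δ p|_{𝔸_L}^{1/2} > 0`, principal complex power
  of a positive real: Mathlib `Complex.norm_cpow_eq_rpow_re_of_pos`);
* §2 `norm_apply_siegelDelta_mul` — for a Siegel section, `‖f(p h)‖ = modDelta(p)^{2 Re s + n} · ‖f h‖` on `P_Δ(𝔸)`;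
  (a continuous `f` is bounded on a compact `K`: Mathlib `IsCompact.exists_bound_of_continuousOn`);
* §3 **`summable_norm_translate_of_height`** — if every `γ h` (`γ ∈ P_Δ(L⁺)\H(L⁺)` read at `Quotient.out`) decomposes as
  `p · k` with `p ∈ P_Δ(𝔸)`, `k ∈ K` compact, and `Φ : H(𝔸) → ℝ_{>0}` is a height of type `(P_Δ, modDelta)`
  (`Φ(p x) = modDelta(p) · Φ(x)`) bounded below on `K` whose `(2 Re s + n)`-th powers are summable over the cosets, then
  `γ ↦ ‖f(γ h)‖` is summable and dominated by `(sup_K ‖f‖ ∕ c^{2 Re s + n}) · Φ(γ h)^{2 Re s + n}`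
  ([Garrett2018, §3.10, proof of 3.10.2: «it suffices to treat … the spherical vector», heights `η_j`]; [MoeglinWaldspurger1995, II.1.5]).

The two remaining organs are separate files of this seat's plan: (I) `Theorems/K2LiuSiegelDoubledIwasawaCompact` (transport of
★ `UnitaryGroupIwasawaAdelic.exists_mem_borelAdelic_mul_mem_standardMaximalCompactGL_cm` from Mok's `J_{2n}` to `J ⊕ (−J)` through
the adapted frame ★ `AdaptedBlocks`), (III) `Theorems/K2LiuSiegelDoubledGodementCount` (the XL engine: [Garrett2018, 3.10.2] for the
Siegel parabolic — integral comparison on `P_Δ(L⁺)\H(𝔸)`, finite volume of `GL_n(L)\GL_n(𝔸_L)^1`).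

HONEST LABEL.  Count-neutral helper of the K2_Liu road; it retires nothing by itself: `HC_CM` is proved only modulo the 7 printed
citations (2 remaining named inputs: hLiu418 = `stmt-HodgeConjecture-24832`, h413 = `stmt-HodgeConjecture-24833`) until rung 0 closes.

## References
* [Liu2021] Y. Liu, *Fourier–Jacobi cycles and arithmetic relative trace formula*, Camb. J. Math. 9 (2021): App. B §B.3 p. 101, Lem. B.10 (2) p. 102.
* [Tan1999] V. Tan, *Poles of Siegel Eisenstein series on `U(n,n)`*, Canad. J. Math. 51 (1999) 164–175: §1.
* [Garrett2018] P. Garrett, *Modern Analysis of Automorphic Forms by Example* (2018), §3.10 (Cor. 3.10.2 and its proof, PDF pp. 179–180).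
* [MoeglinWaldspurger1995] C. Mœglin, J.-L. Waldspurger, *Spectral Decomposition and Eisenstein Series* (1995), II.1.5 (convergence of Eisenstein series; Godement’s lemma).
-/

set_option autoImplicit false
-- the mandated namespace repeats the single-problem summit's segment (`HodgeConjecture.HodgeConjecture`)
set_option linter.dupNamespace false

noncomputable section

open scoped Matrix
open NumberField IsDedekindDomain

namespace Summit.HodgeConjecture.HodgeConjecture.Cruxes.HLiu418.K2LiuSiegelEisensteinDoubledSummableReduction

open Literature.NumberTheory.Automorphic Literature.NumberTheory.GaloisRepresentations
open Literature.NumberTheory.GelbartRogawski1991 Literature.NumberTheory.GelbartRogawski1991.GRConstruction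
open Literature.NumberTheory.K2Lit.SiegelDoubled

variable (L : Type) [Field L] [NumberField L] [IsCMField L]
variable {N M n : ℕ} (e : Fin N × Fin M ≃ Fin n)
  (dV : Fin N → L) (hdV : ∀ i, IsCMField.complexConj L (dV i) = dV i)
  (dW : Fin M → L) (hdW : ∀ i, IsCMField.complexConj L (dW i) = dW i)

/-! ## §1 The norm of the inducing character for a unitary `χ` -/

/-- For a UNITARY Hecke character, `‖χ(det_Δ p)‖ = 1` (★ `chiDet` is `χ` at the unit `det_Δ p`, or `1` off units).
[cite: Tan1999, §1] [cite: Liu2021, §B.3 p. 101] -/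
theorem norm_chiDet_eq_one {χ : HeckeCharacter L} (hχ : χ.IsUnitary) (p : HA L e dV hdV dW hdW) :
    ‖((chiDet L e dV hdV dW hdW χ p : ℂˣ) : ℂ)‖ = 1 := by
  unfold chiDet
  split_ifs with hu
  · exact hχ _
  · simp

/-- **`‖χ(det_Δ p) · |det_Δ p|^{s + n/2}‖ = modDelta(p)^{2 Re s + n}`** for a unitary `χ` (★ `siegelDeltaCharacter χ s p =
chiDet χ p · (modDelta p)^{2s + n}` with `modDelta p = |det_Δ p|^{1/2} > 0`, principal power).
[cite: Tan1999, §1] [cite: Garrett2018, §3.10] -/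
theorem norm_siegelDeltaCharacter {χ : HeckeCharacter L} (hχ : χ.IsUnitary) (s : ℂ) (p : HA L e dV hdV dW hdW) :
    ‖siegelDeltaCharacter L e dV hdV dW hdW χ s p‖ = modDelta L e dV hdV dW hdW p ^ (2 * s.re + (n : ℝ)) := by
  unfold siegelDeltaCharacter
  rw [norm_mul, norm_chiDet_eq_one L e dV hdV dW hdW hχ p, one_mul,
    Complex.norm_cpow_eq_rpow_re_of_pos (modDelta_pos L e dV hdV dW hdW p)]
  congr 1
  simp

/-- The exponent `2 Re s + n` is positive on Godement's half-plane `Re s > n/2` (indeed `> 2n`). [cite: Liu2021, Lem. B.10 (2) p. 102] -/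
theorem two_mul_re_add_pos {s : ℂ} (hs : (n : ℝ) / 2 < s.re) : 0 < 2 * s.re + (n : ℝ) := by
  have hn : (0 : ℝ) ≤ n := Nat.cast_nonneg n
  linarith

/-- On Godement's half-plane the exponent exceeds the critical one: `2n < 2 Re s + n`. [cite: Liu2021, Lem. B.10 (2) p. 102] -/
theorem two_mul_lt_two_mul_re_add {s : ℂ} (hs : (n : ℝ) / 2 < s.re) : 2 * (n : ℝ) < 2 * s.re + (n : ℝ) := by
  linarith

/-! ## §2 Sections: the norm along `P_Δ(𝔸)`, boundedness on compacta -/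

/-- **`‖f(p h)‖ = modDelta(p)^{2 Re s + n} · ‖f(h)‖`** for a Siegel section `f` of `I(s, χ)`, `χ` unitary, `p ∈ P_Δ(𝔸)`.
[cite: Tan1999, §1] [cite: Garrett2018, §3.10] -/
theorem norm_apply_siegelDelta_mul {χ : HeckeCharacter L} (hχ : χ.IsUnitary) {s : ℂ} {f : HA L e dV hdV dW hdW → ℂ}
    (hf : IsSiegelDeltaSection L e dV hdV dW hdW χ s f) {p : HA L e dV hdV dW hdW}
    (hp : IsSiegelDelta L e dV hdV dW hdW p) (h : HA L e dV hdV dW hdW) :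
    ‖f (p * h)‖ = modDelta L e dV hdV dW hdW p ^ (2 * s.re + (n : ℝ)) * ‖f h‖ := by
  rw [hf p hp h, norm_mul, norm_siegelDeltaCharacter L e dV hdV dW hdW hχ s p]

/-! ## §3 The reduction: (I) Iwasawa–compact ∧ (III) Godement's height count ⇒ absolute convergence -/

/-- **Pointwise domination.**  If `x = p · k` with `p ∈ P_Δ(𝔸)`, `k ∈ K`, `‖f‖ ≤ B` on `K`, and `Φ` is a height of type
`(P_Δ, modDelta)` with `Φ ≥ c > 0` on `K`, then `‖f(x)‖ ≤ (B ∕ c^τ) · Φ(x)^τ`, `τ = 2 Re s + n ≥ 0`.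
[cite: Garrett2018, §3.10] [cite: MoeglinWaldspurger1995, II.1.5] -/
theorem norm_apply_le_of_decomp {χ : HeckeCharacter L} (hχ : χ.IsUnitary) {s : ℂ} (hτ : 0 ≤ 2 * s.re + (n : ℝ))
    {f : HA L e dV hdV dW hdW → ℂ} (hf : IsSiegelDeltaSection L e dV hdV dW hdW χ s f)
    {K : Set (HA L e dV hdV dW hdW)} {B : ℝ} (hB : ∀ k ∈ K, ‖f k‖ ≤ B)
    {Φ : HA L e dV hdV dW hdW → ℝ} (hΦpos : ∀ x, 0 < Φ x)
    (hΦ : ∀ p x, IsSiegelDelta L e dV hdV dW hdW p → Φ (p * x) = modDelta L e dV hdV dW hdW p * Φ x)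
    {c : ℝ} (hc : 0 < c) (hcK : ∀ k ∈ K, c ≤ Φ k)
    {x p k : HA L e dV hdV dW hdW} (hp : IsSiegelDelta L e dV hdV dW hdW p) (hk : k ∈ K) (hx : x = p * k) :
    ‖f x‖ ≤ B / c ^ (2 * s.re + (n : ℝ)) * Φ x ^ (2 * s.re + (n : ℝ)) := by
  set τ : ℝ := 2 * s.re + (n : ℝ) with hτdef
  have hmod : 0 < modDelta L e dV hdV dW hdW p := modDelta_pos L e dV hdV dW hdW p
  -- `modDelta p = Φ x / Φ k ≤ Φ x / c`
  have hΦx : Φ x = modDelta L e dV hdV dW hdW p * Φ k := by rw [hx]; exact hΦ p k hp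
  have hmod_le : modDelta L e dV hdV dW hdW p ≤ Φ x / c := by
    rw [le_div_iff₀ hc, hΦx]
    exact mul_le_mul_of_nonneg_left (hcK k hk) hmod.le
  have hpow_le : modDelta L e dV hdV dW hdW p ^ τ ≤ (Φ x / c) ^ τ :=
    Real.rpow_le_rpow hmod.le hmod_le hτ
  calc ‖f x‖ = modDelta L e dV hdV dW hdW p ^ τ * ‖f k‖ := by
        rw [hx]; exact norm_apply_siegelDelta_mul L e dV hdV dW hdW hχ hf hp k
    _ ≤ (Φ x / c) ^ τ * B :=
        mul_le_mul hpow_le (hB k hk) (norm_nonneg _) (Real.rpow_nonneg (div_nonneg (hΦpos x).le hc.le) τ)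
    _ = B / c ^ τ * Φ x ^ τ := by
        rw [Real.div_rpow (hΦpos x).le hc.le]
        ring

/-- **THE REDUCTION «(I) ∧ (III) ⇒ socket #9 at `h`».**  Let `χ` be unitary, `τ := 2 Re s + n ≥ 0`, `f` a continuous Siegel section of
`I(s, χ)` on `H(𝔸) = U(𝕍 ⊕ −𝕍)(𝔸)`.  Suppose (I) every translate `γ · h`, `γ ∈ P_Δ(L⁺)\H(L⁺)` (read at `Quotient.out`), is
`p · k` with `p ∈ P_Δ(𝔸)` and `k` in a fixed compact `K`, and (III) a height `Φ > 0` of type `(P_Δ, modDelta)`, bounded below on `K`,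
has `Σ_γ Φ(γ h)^τ < ∞`.  Then `Σ_γ ‖f(γ h)‖ < ∞` — the conclusion of `sig_K2LiuSiegelEisensteinDoubledSummable` at `h`.
(Godement's proof, step «it suffices to treat the spherical vector»: a continuous section is `O(Φ^τ)` because `P_Δ(𝔸)\H(𝔸)` is
swept by the compact `K`.)  [cite: Garrett2018, §3.10 (proof of Cor. 3.10.2)] [cite: MoeglinWaldspurger1995, II.1.5] [cite: Liu2021, Lem. B.10 (2) p. 102] -/
theorem summable_norm_translate_of_height {χ : HeckeCharacter L} (hχ : χ.IsUnitary) {s : ℂ}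
    (hτ : 0 ≤ 2 * s.re + (n : ℝ)) {f : HA L e dV hdV dW hdW → ℂ}
    (hf : IsSiegelDeltaSection L e dV hdV dW hdW χ s f) (hfc : Continuous f)
    {K : Set (HA L e dV hdV dW hdW)} (hK : IsCompact K)
    {Φ : HA L e dV hdV dW hdW → ℝ} (hΦpos : ∀ x, 0 < Φ x)
    (hΦ : ∀ p x, IsSiegelDelta L e dV hdV dW hdW p → Φ (p * x) = modDelta L e dV hdV dW hdW p * Φ x)
    {c : ℝ} (hc : 0 < c) (hcK : ∀ k ∈ K, c ≤ Φ k) (h : HA L e dV hdV dW hdW)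
    (hdec : ∀ q : SiegelDeltaQuot L e dV hdV dW hdW, ∃ p k : HA L e dV hdV dW hdW,
      IsSiegelDelta L e dV hdV dW hdW p ∧ k ∈ K ∧
        ((Quotient.out q : ratH L e dV hdV dW hdW) : HA L e dV hdV dW hdW) * h = p * k)
    (hsum : Summable (fun q : SiegelDeltaQuot L e dV hdV dW hdW =>
      Φ (((Quotient.out q : ratH L e dV hdV dW hdW) : HA L e dV hdV dW hdW) * h) ^ (2 * s.re + (n : ℝ)))) :
    Summable (fun q : SiegelDeltaQuot L e dV hdV dW hdW =>
      ‖f (((Quotient.out q : ratH L e dV hdV dW hdW) : HA L e dV hdV dW hdW) * h)‖) := by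
  -- a continuous section is bounded on the compact `K` (Mathlib `IsCompact.exists_bound_of_continuousOn`)
  obtain ⟨B, hB⟩ := hK.exists_bound_of_continuousOn hfc.continuousOn
  refine Summable.of_nonneg_of_le (fun _ => norm_nonneg _) (fun q => ?_) (hsum.mul_left (B / c ^ (2 * s.re + (n : ℝ))))
  obtain ⟨p, k, hp, hk, hx⟩ := hdec q
  exact norm_apply_le_of_decomp L e dV hdV dW hdW hχ hτ hf hB hΦpos hΦ hc hcK hp hk hx

/-- **The same with a GLOBAL Iwasawa decomposition `H(𝔸) = P_Δ(𝔸) · K`** (the shape in which organ (I) is delivered) and the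
socket's own hypothesis `n/2 < Re s`: for all `h`, `Σ_{γ ∈ P_Δ(L⁺)\H(L⁺)} ‖f(γ h)‖ < ∞` provided Godement's count
`Σ_γ Φ(γ h)^{2 Re s + n} < ∞` holds at `h`.  [cite: Garrett2018, §3.10 (proof of Cor. 3.10.2)] [cite: Liu2021, Lem. B.10 (2) p. 102] -/
theorem summable_norm_translate_of_iwasawa_of_height {χ : HeckeCharacter L} (hχ : χ.IsUnitary) {s : ℂ}
    (hs : (n : ℝ) / 2 < s.re) {f : HA L e dV hdV dW hdW → ℂ}
    (hf : IsSiegelDeltaSection L e dV hdV dW hdW χ s f) (hfc : Continuous f)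
    {K : Set (HA L e dV hdV dW hdW)} (hK : IsCompact K)
    (hPK : ∀ x : HA L e dV hdV dW hdW, ∃ p k : HA L e dV hdV dW hdW,
      IsSiegelDelta L e dV hdV dW hdW p ∧ k ∈ K ∧ x = p * k)
    {Φ : HA L e dV hdV dW hdW → ℝ} (hΦpos : ∀ x, 0 < Φ x)
    (hΦ : ∀ p x, IsSiegelDelta L e dV hdV dW hdW p → Φ (p * x) = modDelta L e dV hdV dW hdW p * Φ x)
    {c : ℝ} (hc : 0 < c) (hcK : ∀ k ∈ K, c ≤ Φ k) (h : HA L e dV hdV dW hdW)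
    (hsum : Summable (fun q : SiegelDeltaQuot L e dV hdV dW hdW =>
      Φ (((Quotient.out q : ratH L e dV hdV dW hdW) : HA L e dV hdV dW hdW) * h) ^ (2 * s.re + (n : ℝ)))) :
    Summable (fun q : SiegelDeltaQuot L e dV hdV dW hdW =>
      ‖f (((Quotient.out q : ratH L e dV hdV dW hdW) : HA L e dV hdV dW hdW) * h)‖) :=
  summable_norm_translate_of_height L e dV hdV dW hdW hχ (two_mul_re_add_pos (n := n) hs).le hf hfc hK hΦpos hΦ hc hcK h
    (fun _ => hPK _) hsum

end Summit.HodgeConjecture.HodgeConjecture.Cruxes.HLiu418.K2LiuSiegelEisensteinDoubledSummableReduction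

end
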